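import Literature.NumberTheory.Automorphic.ArchKirillovLowestWeightGL2Real
import HarnessLib

/-!
# The sign element `δ_w = diag(-1, 1)_w` of a real place and Kirillov functions on the negative
# half-torus (Jacquet–Langlands (1970), §5; Bump (1997), §2.8)

Topic `NumberTheory/Automorphic`; namespace `Literature.NumberTheory.Automorphic`. Theorems only (no
definition, no named fact, no instance). Seventh brick of the ARCHIMEDEAN Hecke theory of `GL(2)`
in the tree's Gårding-space vocabulary. `ArchKirillovBesselGL2Real` / `ArchKirillovLowestWeightGL2Real`
describe the Kirillov function `u ↦ ℓ(τ(diag(u, 1)_w) v)` of a weight-zero / lowest weight vector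
on the POSITIVE half-torus `u = e^{y} > 0` (`diag(e^y, 1)_w = exp(y H₀)`). The negative half
`u = -e^{y}` is `δ_w exp(y H₀)` for the sign element of the real place `w`,

  `δ_w = 1 - 2 H₀ = diag(-1, 1) ⊗ r_w + 1 ⊗ (1 - r_w) ∈ GL₂(K_∞)`   (`δ_w² = 1`),

so the Kirillov function of `v` on `u < 0` is that of `τ(δ_w) v` on `u > 0`. This file records the
bookkeeping which makes the positive-half-line theorems applicable to `τ(δ_w) v` and to the images
`τ(X^±) v` (Jacquet–Langlands' test vectors `x G`, `y G`, `xy G` are such images):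

* matrix identities: `δ² = 1`, `Ad(δ) H₀ = H₀`, `Ad(δ) H₁ = H₁`, `Ad(δ) X⁺ = -X⁺`, `Ad(δ) X⁻ = -X⁻`,
  `δ exp(yH₀) = exp(yH₀) δ`, and the existence of `δ ∈ GL₂(K_∞)` with matrix `1 - 2H₀`
  (all statements below take an arbitrary `δ` with `(δ : Matrix) = 1 - 2 • H₀`);
* in `End(𝒢)`: `τ(δ) τ(X^±) = -τ(X^±) τ(δ)`, `τ(δ) τ(H_i) = τ(H_i) τ(δ)`, `τ(δ)² = 1`,
  `τ(exp yH₀) τ(δ) = τ(δ) τ(exp yH₀)`;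
* **transport of the spectral data**: if `v` has weight `k`, central parameter `μ` and Casimir
  eigenvalue `λ` at `w`, then `τ(δ) v` has weight `-k`, the same `μ` and `λ`
  (`realSign_weight`, `realSign_central`, `realSign_casimir`), and `δ` exchanges lowest and highest
  weight vectors (`realSign_lowering`, `realSign_raising`);
* **Kirillov functions**: `ℓ(τ(exp yH₀) τ(X⁻) v) = (e^{y} θ - ik) ℓ(τ(exp yH₀) v)` for a weight-`k`
  vector, `ℓ(τ(exp yH₀) τ(δ) τ(X⁺) u) = -e^{y} θ ℓ(τ(exp yH₀) τ(δ) u)` (the Kirillov function of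
  `τ(X⁺) u` is `u' ↦ θ u' φ_u(u')` on BOTH half-lines, Jacquet–Langlands' passage `G ↦ xG`);
  for a weight-zero Casimir eigenvector, `ℓ(τ(exp yH₀) τ(δ) v) = c₋ e^{μy/2} besselMode a ν (e^y)`
  with the SAME `(μ, ν)` as on the positive half-line (`exists_apply_gardingAct_expGL_realSign_eq_besselMode`);
  for a lowest weight vector with `iθ = -a`, `a > 0` (Kirillov function `C u^{(μ+k)/2} e^{-au}` on
  `u > 0`), `ℓ(τ(exp yH₀) τ(δ) v) = 0`: **the Kirillov function of a discrete-series vector vanishes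
  on the negative half-line** (`apply_gardingAct_expGL_realSign_eq_zero_of_lowering`, through the new
  `apply_gardingAct_expGL_eq_zero_of_raising`).

## References

* H. Jacquet, R. P. Langlands, *Automorphic Forms on GL(2)*, LNM 114 (1970), §5, proof of
  Lemma 5.13.1 and Thm. 5.15 (PDF pp. 118–129 of the held retypeset copy). [JacquetLanglands1970]
* D. Bump, *Automorphic Forms and Representations*, CUP 1997, §2.2, §2.8. [Bump1997]
-/

noncomputable section

open MeasureTheory Measure NumberField NumberField.InfinitePlace NumberField.mixedEmbedding IsDedekindDomain Set Filter
open scoped MatrixGroups Topology Classical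

namespace Literature.NumberTheory.Automorphic

variable {K : Type} [Field K] [NumberField K]

-- as in `ArchGardingWhittaker`
set_option backward.isDefEq.respectTransparency false

/-! ### 1. The sign element of a real place: matrix identities -/

section Letters

variable (w : {w : InfinitePlace K // IsReal w})

local notation "H₀" => Matrix.single (0 : Fin 2) (0 : Fin 2) ((Pi.single w 1, 0) : mixedSpace K)
local notation "H₁" => Matrix.single (1 : Fin 2) (1 : Fin 2) ((Pi.single w 1, 0) : mixedSpace K)
local notation "X⁺" => Matrix.single (0 : Fin 2) (1 : Fin 2) ((Pi.single w 1, 0) : mixedSpace K)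
local notation "X⁻" => Matrix.single (1 : Fin 2) (0 : Fin 2) ((Pi.single w 1, 0) : mixedSpace K)

omit [NumberField K] in
/-- `1 - 2H₀ = 1 + (-2) • H₀`. [folklore] -/
theorem realSign_eq_one_add_smul :
    (1 : Matrix (Fin 2) (Fin 2) (mixedSpace K)) - (2 : ℝ) • H₀ = 1 + (-2 : ℝ) • H₀ := by
  rw [neg_smul, sub_eq_add_neg]

omit [NumberField K] in
/-- `Ad(1 + aH₀)` on the letters: `(1 + aH₀) X (1 + bH₀)` for `X = H₀, H₁, X⁺, X⁻`. [folklore] -/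
theorem one_add_smul_hZero_conj (a b : ℝ) :
    (1 + a • H₀) * H₀ * (1 + b • H₀) = (1 + a + b + a * b) • H₀ ∧
    (1 + a • H₀) * H₁ * (1 + b • H₀) = H₁ ∧
    (1 + a • H₀) * X⁺ * (1 + b • H₀) = (1 + a) • X⁺ ∧
    (1 + a • H₀) * X⁻ * (1 + b • H₀) = (1 + b) • X⁻ := by
  obtain ⟨h1, h2, h3, h4, h5, h6, h7⟩ := hZero_mul_letters (K := K) w
  refine ⟨?_, ?_, ?_, ?_⟩ <;> rw [one_add_smul_mul_mul_one_add_smul]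
  · rw [h5, h5]; module
  · rw [h6, h7]; simp only [zero_mul, smul_zero, add_zero]
  · rw [h1, h2]; simp only [smul_zero, add_zero]; module
  · rw [h3, h4]; simp only [zero_mul, smul_zero, add_zero]; module

omit [NumberField K] in
/-- `δ² = 1` for `δ = 1 - 2H₀`. [folklore] -/
theorem realSign_mul_realSign :
    ((1 : Matrix (Fin 2) (Fin 2) (mixedSpace K)) - (2 : ℝ) • H₀) * (1 - (2 : ℝ) • H₀) = 1 := by
  rw [realSign_eq_one_add_smul]
  have h := one_add_smul_mul_mul_one_add_smul (H₀) (1 : Matrix (Fin 2) (Fin 2) (mixedSpace K)) (-2) (-2)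
  rw [mul_one, Matrix.mul_one, Matrix.one_mul, (hZero_mul_letters (K := K) w).2.2.2.2.1] at h
  rw [h]; module

omit [NumberField K] in
/-- `Ad(δ)` on the letters: `δ H₀ δ = H₀`, `δ H₁ δ = H₁`, `δ X⁺ δ = -X⁺`, `δ X⁻ δ = -X⁻`. [folklore] -/
theorem realSign_conj_letters :
    (1 - (2 : ℝ) • H₀) * H₀ * (1 - (2 : ℝ) • H₀) = H₀ ∧ (1 - (2 : ℝ) • H₀) * H₁ * (1 - (2 : ℝ) • H₀) = H₁ ∧
    (1 - (2 : ℝ) • H₀) * X⁺ * (1 - (2 : ℝ) • H₀) = -X⁺ ∧ (1 - (2 : ℝ) • H₀) * X⁻ * (1 - (2 : ℝ) • H₀) = -X⁻ := by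
  obtain ⟨h1, h2, h3, h4⟩ := one_add_smul_hZero_conj (K := K) w (-2) (-2)
  rw [realSign_eq_one_add_smul]
  refine ⟨?_, h2, ?_, ?_⟩
  · rw [h1]; norm_num
  · rw [h3]; norm_num
  · rw [h4]; norm_num

/-- `δ` commutes with `exp(yH₀) = 1 + (e^y - 1)H₀`. [folklore] -/
theorem realSign_mul_coe_expGL (y : ℝ) :
    ((1 : Matrix (Fin 2) (Fin 2) (mixedSpace K)) - (2 : ℝ) • H₀) *
        ((expGL (y • H₀) : GL (Fin 2) (mixedSpace K)) : Matrix (Fin 2) (Fin 2) (mixedSpace K)) =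
      ((expGL (y • H₀) : GL (Fin 2) (mixedSpace K)) : Matrix (Fin 2) (Fin 2) (mixedSpace K)) * (1 - (2 : ℝ) • H₀) := by
  rw [coe_expGL_smul_hZero]
  simp only [sub_mul, mul_sub, add_mul, mul_add, one_mul, mul_one, smul_mul_assoc, mul_smul_comm,
    (hZero_mul_letters (K := K) w).2.2.2.2.1]
  module

omit [NumberField K] in
/-- There is `δ ∈ GL₂(K_∞)` with matrix `1 - 2H₀` (it is its own inverse). [folklore] -/
theorem exists_realSign :
    ∃ δ : GL (Fin 2) (mixedSpace K), (δ : Matrix (Fin 2) (Fin 2) (mixedSpace K)) = 1 - (2 : ℝ) • H₀ :=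
  ⟨⟨1 - (2 : ℝ) • H₀, 1 - (2 : ℝ) • H₀, realSign_mul_realSign w, realSign_mul_realSign w⟩, rfl⟩

-- (the notation `H₀` cannot be used inside `variable`)
variable {w} {δ : GL (Fin 2) (mixedSpace K)}
  (hδ : (δ : Matrix (Fin 2) (Fin 2) (mixedSpace K)) = 1 - (2 : ℝ) • Matrix.single (0 : Fin 2) (0 : Fin 2) ((Pi.single w 1, 0) : mixedSpace K))
include hδ

omit [NumberField K] in
/-- `δ² = 1` in `GL₂(K_∞)`. [folklore] -/
theorem realSign_mul_self : δ * δ = 1 :=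
  Units.ext (by rw [Units.val_mul, hδ, realSign_mul_realSign, Units.val_one])

omit [NumberField K] in
/-- `δ⁻¹ = δ` has matrix `1 - 2H₀`. [folklore] -/
theorem coe_realSign_inv :
    ((δ⁻¹ : GL (Fin 2) (mixedSpace K)) : Matrix (Fin 2) (Fin 2) (mixedSpace K)) = 1 - (2 : ℝ) • H₀ := by
  rw [inv_eq_of_mul_eq_one_right (realSign_mul_self hδ), hδ]

/-- `δ exp(yH₀) = exp(yH₀) δ` in `GL₂(K_∞)`. [folklore] -/
theorem realSign_mul_expGL (y : ℝ) : δ * expGL (y • H₀) = expGL (y • H₀) * δ :=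
  Units.ext (by rw [Units.val_mul, Units.val_mul, hδ, realSign_mul_coe_expGL])

end Letters

/-! ### 2. `τ(δ)` in `End(𝒢)` and the transport of the spectral data -/

section EndIdentities

variable {hcpt : isCompact_glFiniteIntegralLevel 2 K}
  {E : Type*} [NormedAddCommGroup E] [NormedSpace ℂ E] [CompleteSpace E]
  {τ : ContRepresentation ℂ (AutomorphyDatum.gl 2 K hcpt).arch.carrier E}
  (hτ : τ.IsStronglyContinuous) {w : {w : InfinitePlace K // IsReal w}} {δ : GL (Fin 2) (mixedSpace K)}

local notation "H₀" => Matrix.single (0 : Fin 2) (0 : Fin 2) ((Pi.single w 1, 0) : mixedSpace K)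
local notation "H₁" => Matrix.single (1 : Fin 2) (1 : Fin 2) ((Pi.single w 1, 0) : mixedSpace K)
local notation "X⁺" => Matrix.single (0 : Fin 2) (1 : Fin 2) ((Pi.single w 1, 0) : mixedSpace K)
local notation "X⁻" => Matrix.single (1 : Fin 2) (0 : Fin 2) ((Pi.single w 1, 0) : mixedSpace K)
local notation "D" => gardingEnd (hcpt := hcpt) (τ := τ) hτ
local notation "A[" y "]" => gardingAct (hcpt := hcpt) (τ := τ) hτ (expGL ((y : ℝ) • H₀))

variable (hδ : (δ : Matrix (Fin 2) (Fin 2) (mixedSpace K)) = 1 - (2 : ℝ) • Matrix.single (0 : Fin 2) (0 : Fin 2) ((Pi.single w 1, 0) : mixedSpace K))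
include hδ

/-- `τ(δ) τ(H₀) = τ(H₀) τ(δ)`, `τ(δ) τ(H₁) = τ(H₁) τ(δ)`, `τ(δ) τ(X⁺) = -τ(X⁺) τ(δ)`,
`τ(δ) τ(X⁻) = -τ(X⁻) τ(δ)` in `End(𝒢)`. [cite: Knapp1986, Ch. III §3, Prop. 3.9] -/
theorem gardingAct_realSign_mul_letters :
    gardingAct hτ δ * D H₀ = D H₀ * gardingAct hτ δ ∧ gardingAct hτ δ * D H₁ = D H₁ * gardingAct hτ δ ∧
    gardingAct hτ δ * D X⁺ = (-1 : ℂ) • (D X⁺ * gardingAct hτ δ) ∧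
    gardingAct hτ δ * D X⁻ = (-1 : ℂ) • (D X⁻ * gardingAct hτ δ) := by
  obtain ⟨h1, h2, h3, h4⟩ := realSign_conj_letters (K := K) w
  refine ⟨?_, ?_, ?_, ?_⟩ <;> rw [gardingAct_mul_gardingEnd hτ, coe_realSign_inv hδ, hδ]
  · rw [h1]
  · rw [h2]
  · rw [h3, ← neg_one_smul ℝ, gardingEnd_smul, smul_mul_assoc, Complex.ofReal_neg, Complex.ofReal_one]
  · rw [h4, ← neg_one_smul ℝ, gardingEnd_smul, smul_mul_assoc, Complex.ofReal_neg, Complex.ofReal_one]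

/-- The same with `τ(δ)` on the right: `τ(X^±) τ(δ) = -τ(δ) τ(X^±)`. [folklore] -/
theorem gardingEnd_xPlusMinus_mul_gardingAct_realSign :
    D X⁺ * gardingAct hτ δ = (-1 : ℂ) • (gardingAct hτ δ * D X⁺) ∧
    D X⁻ * gardingAct hτ δ = (-1 : ℂ) • (gardingAct hτ δ * D X⁻) := by
  obtain ⟨-, -, h3, h4⟩ := gardingAct_realSign_mul_letters hτ hδ
  refine ⟨?_, ?_⟩
  · rw [h3, smul_smul]; norm_num
  · rw [h4, smul_smul]; norm_num

/-- `τ(δ)² = 1` on `𝒢`. [folklore] -/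
theorem gardingAct_realSign_mul_self : gardingAct (hcpt := hcpt) (τ := τ) hτ δ * gardingAct hτ δ = 1 := by
  rw [← gardingAct_mul, realSign_mul_self hδ, gardingAct_one]

/-- `τ(exp yH₀) τ(δ) = τ(δ) τ(exp yH₀)` on `𝒢`. [folklore] -/
theorem gardingAct_expGL_mul_realSign (y : ℝ) : A[y] * gardingAct hτ δ = gardingAct hτ δ * A[y] := by
  rw [← gardingAct_mul, ← gardingAct_mul, realSign_mul_expGL hδ]

/-- **`τ(δ)` negates the weight**: `τ(W) v = ik v ⟹ τ(W) (τ(δ) v) = -ik τ(δ) v`. [folklore] -/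
theorem realSign_weight {k : ℂ} {v : archGardingSpace hcpt τ} (hW : D (X⁺ - X⁻) v = (Complex.I * k) • v) :
    D (X⁺ - X⁻) (gardingAct hτ δ v) = (Complex.I * (-k)) • gardingAct hτ δ v := by
  obtain ⟨h3, h4⟩ := gardingEnd_xPlusMinus_mul_gardingAct_realSign hτ hδ
  have h : D (X⁺ - X⁻) * gardingAct hτ δ = (-1 : ℂ) • (gardingAct hτ δ * D (X⁺ - X⁻)) := by
    rw [gardingEnd_sub, sub_mul, mul_sub, h3, h4, smul_sub]
  have h' := congrArg (fun T => T v) h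
  simp only [Module.End.mul_apply, LinearMap.smul_apply] at h'
  rw [h', hW, map_smul, smul_smul]
  congr 1
  ring

/-- **`τ(δ)` preserves the central parameter**: `τ(H₀) (τ(δ) v) + τ(H₁) (τ(δ) v) = μ τ(δ) v`. [folklore] -/
theorem realSign_central {μ : ℂ} {v : archGardingSpace hcpt τ} (hZ : D H₀ v + D H₁ v = μ • v) :
    D H₀ (gardingAct hτ δ v) + D H₁ (gardingAct hτ δ v) = μ • gardingAct hτ δ v := by
  obtain ⟨h1, h2, -, -⟩ := gardingAct_realSign_mul_letters hτ hδ
  have h1' := congrArg (fun T => T v) h1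
  have h2' := congrArg (fun T => T v) h2
  simp only [Module.End.mul_apply] at h1' h2'
  rw [← h1', ← h2', ← map_add, hZ, map_smul]

/-- **`τ(δ)` preserves the Casimir eigenvalue of the place `w`**:
`Σ_{i,j} τ(E_{ij} ⊗ r) τ(E_{ji} ⊗ r) (τ(δ) v) = λ τ(δ) v` if the same holds for `v`. [folklore] -/
theorem realSign_casimir {lam : ℂ} {v : archGardingSpace hcpt τ}
    (hC : ∑ i : Fin 2, ∑ j : Fin 2, D (Matrix.single i j ((Pi.single w 1, 0) : mixedSpace K))
        (D (Matrix.single j i ((Pi.single w 1, 0) : mixedSpace K)) v) = lam • v) :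
    ∑ i : Fin 2, ∑ j : Fin 2, D (Matrix.single i j ((Pi.single w 1, 0) : mixedSpace K))
        (D (Matrix.single j i ((Pi.single w 1, 0) : mixedSpace K)) (gardingAct hτ δ v)) = lam • gardingAct hτ δ v := by
  obtain ⟨h1, h2, -, -⟩ := gardingAct_realSign_mul_letters hτ hδ
  -- the Casimir operator commutes with `τ(δ)`
  have hcomm : (D H₀ * D H₀ + D X⁺ * D X⁻ + (D X⁻ * D X⁺ + D H₁ * D H₁)) * gardingAct hτ δ =
      gardingAct hτ δ * (D H₀ * D H₀ + D X⁺ * D X⁻ + (D X⁻ * D X⁺ + D H₁ * D H₁)) := by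
    have e1 : D H₀ * D H₀ * gardingAct hτ δ = gardingAct hτ δ * (D H₀ * D H₀) := by
      rw [mul_assoc, ← h1, ← mul_assoc, ← h1, mul_assoc]
    have e2 : D H₁ * D H₁ * gardingAct hτ δ = gardingAct hτ δ * (D H₁ * D H₁) := by
      rw [mul_assoc, ← h2, ← mul_assoc, ← h2, mul_assoc]
    obtain ⟨h3', h4'⟩ := gardingEnd_xPlusMinus_mul_gardingAct_realSign hτ hδ
    have e3 : D X⁺ * D X⁻ * gardingAct hτ δ = gardingAct hτ δ * (D X⁺ * D X⁻) := by
      rw [mul_assoc, h4', mul_smul_comm, ← mul_assoc, h3', smul_mul_assoc, smul_smul, mul_assoc]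
      norm_num
    have e4 : D X⁻ * D X⁺ * gardingAct hτ δ = gardingAct hτ δ * (D X⁻ * D X⁺) := by
      rw [mul_assoc, h3', mul_smul_comm, ← mul_assoc, h4', smul_mul_assoc, smul_smul, mul_assoc]
      norm_num
    simp only [add_mul, mul_add, e1, e2, e3, e4]
  have h := congrArg (fun T => T v) hcomm
  simp only [Module.End.mul_apply, LinearMap.add_apply] at h
  rw [Fin.sum_univ_two, Fin.sum_univ_two, Fin.sum_univ_two] at hC ⊢
  rw [h, hC, map_smul]

/-- **`δ` sends lowest weight vectors to highest weight vectors**: `τ(L) v = 0 ⟹ τ(R) (τ(δ) v) = 0`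
(`Ad(δ) L = R`). [folklore] -/
theorem realSign_lowering {v : archGardingSpace hcpt τ} (hL : D (H₀ - H₁) v - Complex.I • D (X⁺ + X⁻) v = 0) :
    D (H₀ - H₁) (gardingAct hτ δ v) + Complex.I • D (X⁺ + X⁻) (gardingAct hτ δ v) = 0 := by
  obtain ⟨h1, h2, -, -⟩ := gardingAct_realSign_mul_letters hτ hδ
  obtain ⟨h3, h4⟩ := gardingEnd_xPlusMinus_mul_gardingAct_realSign hτ hδ
  have hH : D (H₀ - H₁) * gardingAct hτ δ = gardingAct hτ δ * D (H₀ - H₁) := by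
    rw [gardingEnd_sub, sub_mul, mul_sub, h1, h2]
  have hX : D (X⁺ + X⁻) * gardingAct hτ δ = (-1 : ℂ) • (gardingAct hτ δ * D (X⁺ + X⁻)) := by
    rw [gardingEnd_add, add_mul, mul_add, h3, h4, smul_add]
  have hH' := congrArg (fun T => T v) hH
  have hX' := congrArg (fun T => T v) hX
  simp only [Module.End.mul_apply, LinearMap.smul_apply] at hH' hX'
  have hL' := congrArg (fun u => gardingAct hτ δ u) hL
  simp only [map_sub, map_smul, map_zero] at hL'
  rw [hH', hX', smul_smul, ← hL']
  module

/-- Dually `τ(R) v = 0 ⟹ τ(L) (τ(δ) v) = 0`. [folklore] -/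
theorem realSign_raising {v : archGardingSpace hcpt τ} (hR : D (H₀ - H₁) v + Complex.I • D (X⁺ + X⁻) v = 0) :
    D (H₀ - H₁) (gardingAct hτ δ v) - Complex.I • D (X⁺ + X⁻) (gardingAct hτ δ v) = 0 := by
  obtain ⟨h1, h2, -, -⟩ := gardingAct_realSign_mul_letters hτ hδ
  obtain ⟨h3, h4⟩ := gardingEnd_xPlusMinus_mul_gardingAct_realSign hτ hδ
  have hH : D (H₀ - H₁) * gardingAct hτ δ = gardingAct hτ δ * D (H₀ - H₁) := by
    rw [gardingEnd_sub, sub_mul, mul_sub, h1, h2]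
  have hX : D (X⁺ + X⁻) * gardingAct hτ δ = (-1 : ℂ) • (gardingAct hτ δ * D (X⁺ + X⁻)) := by
    rw [gardingEnd_add, add_mul, mul_add, h3, h4, smul_add]
  have hH' := congrArg (fun T => T v) hH
  have hX' := congrArg (fun T => T v) hX
  simp only [Module.End.mul_apply, LinearMap.smul_apply] at hH' hX'
  have hR' := congrArg (fun u => gardingAct hτ δ u) hR
  simp only [map_add, map_smul, map_zero] at hR'
  rw [hH', hX', smul_smul, ← hR']
  module

end EndIdentities

/-! ### 3. Kirillov functions of `τ(X⁻) v`, `τ(δ) τ(X⁺) u`, `τ(δ) v` -/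

section Kirillov

variable {hcpt : isCompact_glFiniteIntegralLevel 2 K}
  {E : Type*} [NormedAddCommGroup E] [NormedSpace ℂ E] [CompleteSpace E]
  {τ : ContRepresentation ℂ (AutomorphyDatum.gl 2 K hcpt).arch.carrier E}
  (hτ : τ.IsStronglyContinuous) (w : {w : InfinitePlace K // IsReal w})

local notation "H₀" => Matrix.single (0 : Fin 2) (0 : Fin 2) ((Pi.single w 1, 0) : mixedSpace K)
local notation "H₁" => Matrix.single (1 : Fin 2) (1 : Fin 2) ((Pi.single w 1, 0) : mixedSpace K)
local notation "X⁺" => Matrix.single (0 : Fin 2) (1 : Fin 2) ((Pi.single w 1, 0) : mixedSpace K)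
local notation "X⁻" => Matrix.single (1 : Fin 2) (0 : Fin 2) ((Pi.single w 1, 0) : mixedSpace K)
local notation "D" => gardingEnd (hcpt := hcpt) (τ := τ) hτ
local notation "A[" y "]" => gardingAct (hcpt := hcpt) (τ := τ) hτ (expGL ((y : ℝ) • H₀))

/-- **The Kirillov function of `τ(X⁻) v` for a weight-`k` vector**:
`ℓ(τ(exp yH₀) τ(X⁻) v) = (e^{y} θ - ik) ℓ(τ(exp yH₀) v)` (`X⁻ = X⁺ - W`). [folklore] -/
theorem apply_gardingAct_expGL_xMinus {ℓ : archGardingSpace hcpt τ →ₗ[ℂ] ℂ} {θ : ℂ}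
    (hθ : ∀ u : archGardingSpace hcpt τ, ℓ (D X⁺ u) = θ * ℓ u) {k : ℂ} (v : archGardingSpace hcpt τ)
    (hW : D (X⁺ - X⁻) v = (Complex.I * k) • v) (y : ℝ) :
    ℓ (A[y] (D X⁻ v)) = ((Real.exp y : ℂ) * θ - Complex.I * k) * ℓ (A[y] v) := by
  have hXm : D X⁻ v = D X⁺ v - D (X⁺ - X⁻) v := by rw [gardingEnd_sub, LinearMap.sub_apply]; abel
  rw [hXm, hW, map_sub, map_smul, map_sub, map_smul, apply_gardingAct_expGL_xPlus hτ w hθ v y, smul_eq_mul]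
  ring

variable {δ : GL (Fin 2) (mixedSpace K)}
  (hδ : (δ : Matrix (Fin 2) (Fin 2) (mixedSpace K)) = 1 - (2 : ℝ) • Matrix.single (0 : Fin 2) (0 : Fin 2) ((Pi.single w 1, 0) : mixedSpace K))
include hδ

/-- **The Kirillov function of `τ(X⁺) u` on the negative half-line**:
`ℓ(τ(exp yH₀) τ(δ) τ(X⁺) u) = -e^{y} θ ℓ(τ(exp yH₀) τ(δ) u)` — together with
`apply_gardingAct_expGL_xPlus`: the Kirillov function of `τ(X⁺) u` is `u' ↦ θ u' φ_u(u')` on all of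
`ℝˣ` (Jacquet–Langlands' `G ↦ xG`). [cite: JacquetLanglands1970, §5, proof of Lemma 5.13.1] -/
theorem apply_gardingAct_expGL_realSign_xPlus {ℓ : archGardingSpace hcpt τ →ₗ[ℂ] ℂ} {θ : ℂ}
    (hθ : ∀ u : archGardingSpace hcpt τ, ℓ (D X⁺ u) = θ * ℓ u) (u : archGardingSpace hcpt τ) (y : ℝ) :
    ℓ (A[y] (gardingAct hτ δ (D X⁺ u))) = -((Real.exp y : ℂ) * θ) * ℓ (A[y] (gardingAct hτ δ u)) := by
  obtain ⟨-, -, h3, -⟩ := gardingAct_realSign_mul_letters hτ hδ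
  have h3' := congrArg (fun T => T u) h3
  simp only [Module.End.mul_apply, LinearMap.smul_apply] at h3'
  rw [h3', map_smul, map_smul, apply_gardingAct_expGL_xPlus hτ w hθ _ y, smul_eq_mul]
  ring

/-- **The Kirillov function of a weight-zero Casimir eigenvector on the negative half-line is again
a `K`-Bessel function with the same parameters**: `ℓ(τ(exp yH₀) τ(δ) v) = c₋ e^{μy/2} besselMode a ν (e^y)`
(`τ(δ) v` is again of weight `0` with the same `μ`, `λ`; `ArchKirillovBesselGL2Real`). Hence
`ℓ(τ(diag(u,1)_w) v) = c_{sgn u} |u|^{μ/2} besselMode a ν |u|` on `ℝˣ` (Jacquet–Langlands (1970), §5: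
`W_G(a(u)) ∝ |u|^{(s₁+s₂)/2} |u|^{1/2} K_{(s₁-s₂)/2}(2π|u|)`; the two constants agree up to the sign
`τ_w(δ) = ±1` of the `O(2)`-type). [cite: JacquetLanglands1970, §5, Lemma 5.13.1 and Thm. 5.15]
[cite: Bump1997, Thm. 2.8.1] -/
theorem exists_apply_gardingAct_expGL_realSign_eq_besselMode (hτb : ∀ g, ‖(τ g : E →L[ℂ] E)‖ ≤ 1)
    {ℓ : archGardingSpace hcpt τ →ₗ[ℂ] ℂ}
    (hℓ : ∃ (C : ℝ) (𝒮 : Finset (List (Matrix (Fin 2) (Fin 2) (mixedSpace K)))), 0 ≤ C ∧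
      ∀ v : archGardingSpace hcpt τ, ‖ℓ v‖ ≤ C * ∑ w ∈ 𝒮, ‖archWordDerivE hcpt τ w v‖)
    {θ : ℂ} (hθ : ∀ u : archGardingSpace hcpt τ, ℓ (D X⁺ u) = θ * ℓ u)
    {a : ℝ} (ha : 0 < a) (hθa : θ ^ 2 = -((a : ℂ) ^ 2))
    (μ lam ν : ℂ) (hlam : lam = μ ^ 2 / 2 - 2 * ν ^ 2 - 1 / 2) (v : archGardingSpace hcpt τ)
    (hW : D (X⁺ - X⁻) v = 0) (hZ : D H₀ v + D H₁ v = μ • v)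
    (hC : ∑ i : Fin 2, ∑ j : Fin 2, D (Matrix.single i j ((Pi.single w 1, 0) : mixedSpace K))
        (D (Matrix.single j i ((Pi.single w 1, 0) : mixedSpace K)) v) = lam • v) :
    ∃ c : ℂ, ∀ y : ℝ, ℓ (A[y] (gardingAct hτ δ v)) = c * (Real.exp y : ℂ) ^ (μ / 2) * besselMode a ν (Real.exp y) := by
  have hW0 : D (X⁺ - X⁻) v = (Complex.I * 0) • v := by rw [hW, mul_zero, zero_smul]
  have hW' : D (X⁺ - X⁻) (gardingAct hτ δ v) = 0 := by
    rw [realSign_weight hτ hδ hW0, neg_zero, mul_zero, zero_smul]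
  exact exists_apply_gardingAct_expGL_eq_besselMode hτ w hτb hℓ hθ ha hθa μ lam ν hlam (gardingAct hτ δ v) hW'
    (realSign_central hτ hδ hZ) (realSign_casimir hτ hδ hC)

omit hδ in
/-- **A highest weight vector with `re(iθ) < 0` has vanishing Kirillov function on the positive
half-torus** (dual to `apply_gardingAct_expGL_eq_zero_of_lowering`): `τ(R) v = 0` gives
`f = C e^{(μ-k)y/2} e^{-iθ e^y}`, of moderate growth only for `C = 0`. [cite: JacquetLanglands1970, §5 and Thm. 5.15] -/
theorem apply_gardingAct_expGL_eq_zero_of_raising (hτb : ∀ g, ‖(τ g : E →L[ℂ] E)‖ ≤ 1)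
    {ℓ : archGardingSpace hcpt τ →ₗ[ℂ] ℂ}
    (hℓ : ∃ (C : ℝ) (𝒮 : Finset (List (Matrix (Fin 2) (Fin 2) (mixedSpace K)))), 0 ≤ C ∧
      ∀ v : archGardingSpace hcpt τ, ‖ℓ v‖ ≤ C * ∑ w ∈ 𝒮, ‖archWordDerivE hcpt τ w v‖)
    {θ : ℂ} (hθ : ∀ u : archGardingSpace hcpt τ, ℓ (D X⁺ u) = θ * ℓ u) (hθi : (Complex.I * θ).re < 0)
    (k μ : ℂ) (v : archGardingSpace hcpt τ)
    (hW : D (X⁺ - X⁻) v = (Complex.I * k) • v) (hZ : D H₀ v + D H₁ v = μ • v)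
    (hR : D (H₀ - H₁) v + Complex.I • D (X⁺ + X⁻) v = 0) (y : ℝ) :
    ℓ (A[y] v) = 0 := by
  obtain ⟨C, hC⟩ := exists_apply_gardingAct_expGL_eq_of_raising hτ w hℓ hθ k μ v hW hZ hR
  obtain ⟨M, N, -, hgrow⟩ := exists_norm_apply_gardingAct_expGL_le hτ w hτb hℓ v
  have hα : 0 < (-(Complex.I * θ)).re := by rw [Complex.neg_re]; linarith
  have hC0 : C = 0 := by
    refine eq_zero_of_norm_mul_exp_exp_le (β := ((μ - k) / 2).re) (M := M) (N := N) hα fun x hx => ?_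
    have h := hgrow x
    rw [abs_of_nonneg hx, hC x, norm_mul, Complex.norm_exp, Complex.sub_re, Complex.re_mul_ofReal,
      Complex.re_mul_ofReal, sub_eq_add_neg, ← neg_mul, ← Complex.neg_re, Real.exp_add, ← mul_assoc] at h
    exact h
  rw [hC y, hC0, zero_mul]

/-- **The Kirillov function of a lowest weight (discrete series) vector vanishes on the negative
half-line**: if `τ(L) v = 0`, `τ(W) v = ik v`, `τ(H₀) v + τ(H₁) v = μ v` and `iθ = -a`, `a > 0` (so that
on `u > 0` the Kirillov function is `C u^{(μ+k)/2} e^{-au}`, `ArchKirillovLowestWeightGL2Real`), then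
`ℓ(τ(exp yH₀) τ(δ) v) = 0` for all `y`: `τ(δ) v` is a highest weight vector with the same `θ`
(Jacquet–Langlands (1970), §5: the Kirillov space of `σ(μ₁, μ₂)` lives on `u > 0` for this `ψ`).
[cite: JacquetLanglands1970, §5 and Thm. 5.15] -/
theorem apply_gardingAct_expGL_realSign_eq_zero_of_lowering (hτb : ∀ g, ‖(τ g : E →L[ℂ] E)‖ ≤ 1)
    {ℓ : archGardingSpace hcpt τ →ₗ[ℂ] ℂ}
    (hℓ : ∃ (C : ℝ) (𝒮 : Finset (List (Matrix (Fin 2) (Fin 2) (mixedSpace K)))), 0 ≤ C ∧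
      ∀ v : archGardingSpace hcpt τ, ‖ℓ v‖ ≤ C * ∑ w ∈ 𝒮, ‖archWordDerivE hcpt τ w v‖)
    {θ : ℂ} (hθ : ∀ u : archGardingSpace hcpt τ, ℓ (D X⁺ u) = θ * ℓ u)
    {a : ℝ} (ha : 0 < a) (hθa : Complex.I * θ = -(a : ℂ))
    (k μ : ℂ) (v : archGardingSpace hcpt τ)
    (hW : D (X⁺ - X⁻) v = (Complex.I * k) • v) (hZ : D H₀ v + D H₁ v = μ • v)
    (hL : D (H₀ - H₁) v - Complex.I • D (X⁺ + X⁻) v = 0) (y : ℝ) :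
    ℓ (A[y] (gardingAct hτ δ v)) = 0 := by
  have hθi : (Complex.I * θ).re < 0 := by
    rw [hθa, Complex.neg_re, Complex.ofReal_re]; linarith
  exact apply_gardingAct_expGL_eq_zero_of_raising hτ w hτb hℓ hθ hθi (-k) μ (gardingAct hτ δ v)
    (realSign_weight hτ hδ hW) (realSign_central hτ hδ hZ) (realSign_lowering hτ hδ hL) y

end Kirillov

end Literature.NumberTheory.Automorphic
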